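import Mathlib
import HarnessLib
import Literature.Analysis.FluidPDE.CoordDerivatives
import Summits.NavierStokesRegularity.NavierStokesRegularity.Theses.PoloidalWindowDoor
import Summits.NavierStokesRegularity.NavierStokesRegularity.Theorems.PoloidalWindowDoorPoloidalWindowRigidityClebsch
import Summits.NavierStokesRegularity.NavierStokesRegularity.Theorems.PoloidalWindowDoorPoloidalWindowRigidityFirstIntegral
import Summits.NavierStokesRegularity.NavierStokesRegularity.Theorems.PoloidalWindowRigidity.Negative.FalseWithoutMild
import Summits.NavierStokesRegularity.NavierStokesRegularity.Theorems.PoloidalWindowDoorPoloidalWindowRigidityStubUntwisted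

/-!
# Disproof work file — crux `PoloidalWindowRigidity` (K2, stmt-NavierStokesRegularity-19708), TWISTING class

DISPROVER seat `cdisprove-stmt-NavierStokesRegularity-19708-g0` (director-ns g9 req30 (2)): «construct / locate a bounded or
Type-I twisting poloidal steady or ancient NS germ in the window class» — the residue `stub_twisting` of the picked line
`Lines/lrc_jet.lean` v5 (untwisted half CLOSED: `…Theorems.PoloidalWindowDoorPoloidalWindowRigidityStubUntwisted.stub_untwisted`,
p561151).  VERDICT OF THIS FILE: **no kill** of the crux or of `stub_twisting` as typed; a typed census of the twisting class
(§C), one kernel lemma placing the printed Liouville class inside the already-closed stratum (§K), and a finite-type reduction of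
the symmetric (oblique-2.5D) twisting germs with a numerical emptiness verdict for their THICK part (§S, jobs j289657 / j289848).

## FIRST ENTRIES — refuter1 K-47 / K-48 (ns-regularity-refuter1 g6; STATUS 2026-08-27T20:15:12Z, 20:40:15Z)
* K-47 I `Theorems/LrcModEntire/Negative/TwistedColumnODE.lean` — **p565534 ACCEPTED** (defs + ODE lemmas of the twisted (TH) column); K-47 II
  `TwistedColumnField` p567942 in review; III–VII staged: `twisting_false_without_mild[_frozen_analytic]` (= `stub_twisting` with the Oseen-mild
  identity (M) deleted is FALSE, even keeping div-free + frozen `ω·∇v₂ = 0` + slice-analytic + `‖V‖ ≤ 10`), `twistingTH_false_without_mild[…]`,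
  `twistingGerm_false_without_mild[…]` (the (M)-less sibling stubs of `LrcModEntire`, stmt-…-20428).  Witness `twistProfile`, the twisted (TH) column
  `v = (−t)^{-1/2} (−P₁(x₂) sin x₀, −Q₁(x₂) sin x₁, P(x₂) cos x₀ + Q(x₂) cos x₁)`, `W = 2 + cos x₂`, `θ′ = W²`, `(P,Q) = (cos θ, sin θ)/W`, `P₁′ = mP`,
  `Q₁′ = mQ`, slope `m(x₂) = −1 + 6/W − 6/W² − W⁴` (non-constant), twist `−(−t)^{-1} sin x₀ sin x₁`, apex singular, no symmetry germ.
  ⇒ (M) is LOAD-BEARING for `stub_twisting`; (TH) ∩ twisting is KINEMATICALLY inhabited; DIRECTOR-NS #62 (1): every (TH) certificate must input (M).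
* K-48: `stub_twistingThick` ∖ (M) — NO closed-form witness; the (M)-free frozen kinematics is ONE scalar equation `u_zz + Δₕ[G(u,z)] = 0` (`u = v₂`,
  `∂_zφ = G(u,z)`; (TH) ⇔ `G` affine in `u`, THICK ⇔ `G_uu ≠ 0`); elliptic regime empty for bounded entire profiles (`divFormLiouville`), hyperbolic
  regime = eternal solutions of a genuinely non-linear 2+1 wave equation — existence plausible, uncertified.
* Earlier (landed): `Negative.poloidalWindowRigidity_false_without_mild` (parasitic drift) — (M) cannot be dropped from the crux itself.

## §C  CENSUS of twisting poloidal germs — «excluded» = no backward-singular Type-I ancient mild profile of the class carries such a germ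
EXCLUDED BY PRINT (locators from the materialised pages; nothing below is used as an axiom):
 (P1) continuous alignment / CONSTANT vorticity direction: Giga–Miura, CMP 303 (2011) doi:10.1007/s00220-011-1197-x (acq-01588, cite-only; statement
      via Giga–Hsu–Maekawa arXiv:1310.6471 p.3 L28–32, p.4 Thm 1.2, p.16 Step 3): Type-I blow-up is excluded when the vorticity direction is UNIFORMLY
      continuous in space; the blow-up limit has constant direction, is 2-D, hence trivial (their Liouville theorem).  A twisting window supplies no
      uniform continuity (refuter1 K-48 (c) [corpus: arXiv:2501.08976 p.3]) — and the constant-direction class is in fact INSIDE THE TREE's closed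
      stratum: `twist_eq_zero_of_constDir` / `not_singular_of_constDir_window` (§K, kernel) — constant direction on a window ⇒ untwisted ⇒ regular by
      the landed `stub_untwisted` (p561151).  So (P1) removes NOTHING from the twisting residue and needs no literature fact.
 (P2) ω₃ ≡ 0 with axisymmetric / double-cone geometry: Lei–Ren arXiv:2501.08976 p.4 Thm 1.1; their Rem 1.3 (p.4 L40–52) flags the NON-axisymmetric
      ω₃ ≡ 0 case as OPEN — exactly the twisting residue.  Axisymmetric poloidal-along-e₃ slices (swirl `C/r` allowed) are untwisted (radial level sets).
 (P3) axisymmetric Type-I (KNSS arXiv:0709.3599, Seregin–Šverák 2009) — untwisted anyway; (P4) backward self-similar (NRŠ 1996 / Tsai 1998; tree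
      `Literature.Analysis.FluidPDE.SelfSimilar`) — a symmetry class transversal to the split, no twisting member known.
EXCLUDED BY THE TREE (landed): aligned / flat / two-directions / (TV) constant-slope / untwisted strata (`stub_untwisted` p561151, `stub_untwistedGerm`
 p560652, route-file kernel remarks).
WHAT REMAINS — kernel statement `stubTwisting_iff_residues` (§C below): `stub_twisting` ⇔ ¬`TwistingTHResidue` ∧ ¬`TwistingThickResidue`, i.e.
 (R-TH)  a singular class profile with a twisting, (TV)-pinned window whose slope is a function of (t, x₂): KINEMATICALLY INHABITED without (M) (K-47);
         NS-status OPEN; lanes: cert-1 g3 / nsreg-p7 engines, `twist_split::stub_twistingTH` (20428), `mixed_type::stub_hyperbolicTH`.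
 (R-THICK) a singular class profile with a THICK twisting window: NO witness of any kind (not even (M)-free kinematic: K-48); lanes:
         `twist_split::stub_twistingThick`, `mixed_type::stub_hyperbolicThick` (+ the thick part of `stub_semiElliptic`).  §S: its velocity-symmetric
         sub-case is numerically EMPTY already at the level of steady germs.

## §S  VELOCITY-SYMMETRIC twisting germs = oblique 2.5D; finite type; the thick part is numerically EMPTY
A twisting poloidal steady germ whose VELOCITY field is invariant under a one-parameter group of translations or of rotations about a vertical axis
is necessarily invariant under an OBLIQUE translation `d = (sin β, 0, cos β)`, `0 < β < π/2` (rotational symmetry or horizontal `d` force twist ≡ 0;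
vertical `d` violates the non-degeneracy clause of `stub_twisting`).  CAVEAT: the symmetry alternatives (1)/(2) of `LrcModEntire` are stated for the
VORTICITY slice (`∂_e curl v = 0`, `rotGen`-equivariance of `curl v`); velocity = symmetric field + harmonic gradient, a strictly larger class NOT covered
here (Burgers/Craik-type strained layers `v = Ax + f(k·x) b` are in it and are ALIGNED, hence closed, but the general dressed class is unanalysed).
Writing `v = U(g) e_A + ℬ e_y + g d` (`e_A = (cos β, 0, −sin β)`; functions of `X = x·e_A`, `Y = x₁`; the first integral `ω·∇v₂ = 0` — automatic for
poloidal NS — forces `u_A = U(g)`), `T = tan β`, `W = U + T·id`, steady NS + poloidal-along-e₂ is EQUIVALENT (paper proof, NOTES.md §2.5D; the 2-D vorticity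
equation is then automatic) to
  (E1) ℬ_X = W′(g) g_Y,   (E2) ℬ_Y = −U′(g) g_X,   (γ) Δg = U(g) g_X + ℬ g_Y + c   (c = pressure gradient along d)   — `IsOblique25Germ` below —
whose compatibility gives  T·g_XX = W″(g)|∇g|² + W′(g)(U g_X + ℬ g_Y + c) =: T·P,  g_YY = Q := (U g_X + ℬ g_Y + c) − P.  Hence FINITE TYPE: a germ is
determined by (g, g_X, g_Y, ℬ, g_XY) at one point together with (W, T, c); the slope is a function of `w` alone (constant ⇔ W linear ⇔ (TV); THICK ⇔
W″ ≠ 0); twist ∝ P g_Y − g_XY g_X; type indicator `I = ⟨∂₂vₕ, ∇ₕw⟩ = −sin β (cos β − U′ sin β)·[cos β (sin β + U′ cos β) g_X² + W′(g) g_Y²]` (for `U ≡ 0`: hyperbolic, `I < 0`).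
Solutions ⇔ vanishing of the Frobenius tower of I₁ := D_X(D_X Q) − D_Y(D_Y P) (95-term numerator, ∂I₁/∂W⁗ = −T²|∇g|⁴ ≠ 0; for W = a + b·g it factors
−4Tb(b−T)·[…]: branches b = T (`oblique25_cubic_example`, kernel-checked: `u = (0, aX)`, `g = aY/T + a²X³/(6T)`, twisting, (TV), hyperbolic), b = 0
(`ℬ = V(Y)`, `V‴ = VV″ − V′²`, e.g. `V = −6/Y`, `g = 6X/(TY²) + w₀/T + cY²/20 + …`, twisting, (TV)) and the bracket branch).  Parameter count: genuine
tower conditions through order K number K(K+1)/2 on an 11-dimensional jet space and the solution set must be ≥ 2-dimensional (translations) ⇒ order 4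
is the first over-determined level.  NUMERICS (kit, tag ns, workitem 19708; normalisation g_Y(0) = 1 and, in the «thick» runs, W″(g₀) = 1):
  j289657 — order ≤ 2 (N=4): exact solutions, Jacobian rank 6/12 (= the 6 genuine conditions); order ≤ 4 (N=6): NO exact solution in 48 multistarts
            (floors 1e-9…1e-6, all along the degenerate escape T → ±∞ = horizontal d = untwisted limit, twist → 0); order ≤ 6 (N=8): none in 36
            (best 2.2e-6); order ≤ 8 (N=10): none in 12 (best 3.0e-6).  DECISIVE CONTROL «C» (W″ left FREE, order ≤ 4, 36 starts): the optimiser DOES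
            reach exact solutions (cost 1e-161…1e-33) and EVERY one of them has W″ = W‴ = W⁗ = 0 with W′ ∈ {0, T} or on the bracket branch — i.e. the
            free search lands exactly on the (TV) W-linear families (twisting: |twist| up to 0.64), never on a thick point.
  j289848 — order ≤ 3 (N=5, W″ = 1): 142/160 starts EXACT (1e-31) with Jacobian nullity 3 at every inspected point (= 2 translations + the one
            unconstrained Taylor coefficient — exactly the count: the order-≤3 variety IS the predicted 2-parameter family of translation orbits);
            the order-4 conditions, minimised over the only new unknown (affine, linearisation error 0), have residual ≥ 1.1e-2 at ALL 60 exact sample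
            points (T ∈ (−18, 10)), against ≤ 5e-33 (machine zero) at the 47 exact points of the W-linear control run through the same pipeline;
            full re-optimisation from the exact seeds: order ≤ 4 (N=6) 0/48 exact (best 9.5e-11, again only with |T| = 134…3137, g_X → 0, twist → 0),
            order ≤ 5 (N=7) 0/24 (best 5e-8, |T| ≥ 93); second normalisation g_Y(0) = 0.3 (equivalent by the 2-parameter scaling of the system):
            83/96 exact at order ≤ 3, order-4 floors ≥ 6.5e-9 (smaller jets, smaller absolute residuals; no zero).
READING: every velocity-symmetric twisting steady germ found is (TV) (closed by `stub_constSlope` territory); the THICK twisting class, if inhabited at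
all, has no velocity-level continuous symmetry.  This is a NUMERICAL verdict on a truncated prolongation — recorded as the `sorry`d statement
`noThickObliqueTwistingGerm`; an exact elimination (resultants/Gröbner on the 11 jet variables; polynomials of 10³–10⁶ terms) was not attempted.

## Targets
* `lrc_jet::stub_twisting` (v5): NO KILL.  A kill needs a backward-singular Type-I ancient mild poloidal profile (open: Lei–Ren Rem 1.3); the class
  definitions are honest (`v ≡ 0` satisfies every hypothesis with a regular apex; `C < 0` is vacuous; `IsBackwardSingularPoint` is the genuine
  `L^∞ = ∞` on every parabolic cylinder), so no junk instance bites.  Load-bearing: (M) (K-47).  Typed residue: `stubTwisting_iff_residues`.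
* `mixed_type::stub_semiElliptic / stub_hyperbolicTH / stub_hyperbolicThick` (cstrat v1, 20:38Z): NO KILL (same reason).  Information: K-47's column is
  hyperbolic-(TH); the velocity-symmetric germs of §S are hyperbolic on the branch `U′ ≡ 0` (the cubic example) and of either/mixed type in general (sign of the bracket in `I` above);
  no thick germ of either type is known.

WHAT THIS IS NOT: not a proof or disproof of Navier–Stokes regularity, of the crux, or of `stub_twisting`; kernel content = §K only.
-/

noncomputable section

set_option linter.dupNamespace false

namespace Summit.NavierStokesRegularity.NavierStokesRegularity.Cruxes.PoloidalWindowRigidity.Disproof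

open MeasureTheory Set Function Filter Topology Metric
open scoped RealInnerProductSpace InnerProductSpace ContDiff
open Literature.Analysis Literature.Analysis.FluidPDE
open Summit.NavierStokesRegularity.NavierStokesRegularity.Theorems.PoloidalWindowDoorPoloidalWindowRigidityClebsch
open Summit.NavierStokesRegularity.NavierStokesRegularity.Theorems.PoloidalWindowDoorPoloidalWindowRigidityWindow

local notation "ℝ³" => EuclideanSpace ℝ (Fin 3)
local notation "𝐞" i => (EuclideanSpace.single i (1 : ℝ) : EuclideanSpace ℝ (Fin 3))

/-! ## §K  Kernel lemma: constant vorticity direction + frozen ⇒ untwisted -/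

/-- The twist density of a slice field `u` at `y` — VERBATIM the quantity of `stub_twisting` (lrc_jet v5):
`∂₀(∂₂u₂)·∂₁u₂ − ∂₁(∂₂u₂)·∂₀u₂`, the horizontal Poisson bracket `{∂₂u₂, u₂}ₕ`. -/
def twist (u : ℝ³ → ℝ³) (y : ℝ³) : ℝ :=
  fderiv ℝ (fun x => fderiv ℝ u x (𝐞 2) 2) y (𝐞 0) * fderiv ℝ u y (𝐞 1) 2 -
    fderiv ℝ (fun x => fderiv ℝ u x (𝐞 2) 2) y (𝐞 1) * fderiv ℝ u y (𝐞 0) 2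

/-- Component of a derivative = derivative of the component (`u` differentiable at `x`). [folklore] -/
theorem fderiv_coord (u : ℝ³ → ℝ³) {x : ℝ³} (hu : DifferentiableAt ℝ u x) (h : ℝ³) (i : Fin 3) :
    fderiv ℝ (fun z => u z i) x h = fderiv ℝ u x h i := by
  have hc := ((EuclideanSpace.proj (𝕜 := ℝ) i).hasFDerivAt.comp x hu.hasFDerivAt).fderiv
  have hfun : (fun z => u z i) = (EuclideanSpace.proj (𝕜 := ℝ) i) ∘ u := rfl
  rw [hfun, hc]
  rfl

/-- Elementary 2-D linear algebra: two vectors both orthogonal to a nonzero `(ξ₀, ξ₁)` are parallel. [folklore] -/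
theorem det_eq_zero_of_orth {ξ₀ ξ₁ a₀ a₁ b₀ b₁ : ℝ} (hξ : ξ₀ ≠ 0 ∨ ξ₁ ≠ 0)
    (ha : ξ₀ * a₀ + ξ₁ * a₁ = 0) (hb : ξ₀ * b₀ + ξ₁ * b₁ = 0) : b₀ * a₁ - b₁ * a₀ = 0 := by
  rcases hξ with h | h
  · have : ξ₀ * (b₀ * a₁ - b₁ * a₀) = 0 := by linear_combination a₁ * hb - b₁ * ha
    exact (mul_eq_zero.1 this).resolve_left h
  · have : ξ₁ * (b₀ * a₁ - b₁ * a₀) = 0 := by linear_combination (-a₀) * hb + b₀ * ha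
    exact (mul_eq_zero.1 this).resolve_left h

/-- **Constant vorticity direction + frozen ⇒ untwisted.**  Let `u` be a smooth slice, `U` open, and suppose on `U`: the
vorticity is a (pointwise) multiple of ONE fixed vector `ξ` and nonzero, the slice is poloidal along `e₂` (`(curl u)₂ = 0`), and
the first integral `⟪Du·curl u, e₂⟫ = 0` (tree `stub_firstIntegral`, i.e. `ω·∇u₂ = 0`) holds.  Then the twist density vanishes
on `U`.  Hence the constant-direction class of Giga–Miura 2011 (the blow-up limits under continuous alignment) lies in the
UNTWISTED stratum already closed by `stub_untwisted` — it contributes nothing to the twisting residue. [folklore] -/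
theorem twist_eq_zero_of_constDir {u : ℝ³ → ℝ³} (hu : ContDiff ℝ ∞ u) {U : Set ℝ³} (hU : IsOpen U) (ξ : ℝ³)
    (hdir : ∀ y ∈ U, ∃ l : ℝ, curl u y = l • ξ) (hne : ∀ y ∈ U, curl u y ≠ 0)
    (hpol : ∀ y ∈ U, curl u y 2 = 0)
    (hfi : ∀ y ∈ U, ⟪fderiv ℝ u y (curl u y), 𝐞 2⟫_ℝ = 0) :
    ∀ y ∈ U, twist u y = 0 := by
  intro y hy
  obtain ⟨l, hl⟩ := hdir y hy
  have hl0 : l ≠ 0 := by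
    rintro rfl
    exact hne y hy (by rw [hl, zero_smul])
  have hξ2 : ξ 2 = 0 := by
    have h := hpol y hy
    rw [hl, PiLp.smul_apply, smul_eq_mul] at h
    exact (mul_eq_zero.1 h).resolve_left hl0
  have hξ : ξ 0 ≠ 0 ∨ ξ 1 ≠ 0 := by
    by_contra h
    push Not at h
    apply hne y hy
    rw [hl]
    have hz : ξ = 0 := by
      ext i
      fin_cases i
      · simpa using h.1
      · simpa using h.2
      · simpa using hξ2
    rw [hz, smul_zero]
  -- the scalar `w = u₂` and its coordinate partial derivatives
  set w : ℝ³ → ℝ := fun x => u x 2 with hw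
  have hws : ContDiff ℝ ∞ w := (EuclideanSpace.proj (2 : Fin 3) : ℝ³ →L[ℝ] ℝ).contDiff.comp hu
  have hud : ∀ x, DifferentiableAt ℝ u x := fun x => (hu.differentiable (by simp)).differentiableAt
  have hpd : ∀ (x : ℝ³) (k : Fin 3), pderiv k w x = fderiv ℝ u x (𝐞 k) 2 := fun x k => by
    rw [pderiv_apply]
    exact fderiv_coord u (hud x) _ 2
  -- (1) on `U`, the horizontal gradient of `w` is orthogonal to `(ξ₀, ξ₁)`
  have horth : ∀ x ∈ U, ξ 0 * pderiv 0 w x + ξ 1 * pderiv 1 w x = 0 := by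
    intro x hx
    obtain ⟨l', hl'⟩ := hdir x hx
    have hl'0 : l' ≠ 0 := by
      rintro rfl
      exact hne x hx (by rw [hl', zero_smul])
    have h := hfi x hx
    simp only [EuclideanSpace.inner_single_right, one_mul, conj_trivial] at h
    rw [fderiv_apply_curl_two, hl', PiLp.smul_apply, PiLp.smul_apply, PiLp.smul_apply, smul_eq_mul, smul_eq_mul,
      smul_eq_mul, hξ2, ← hpd x 0, ← hpd x 1] at h
    have h' : l' * (ξ 0 * pderiv 0 w x + ξ 1 * pderiv 1 w x) = 0 := by linear_combination h
    exact (mul_eq_zero.1 h').resolve_left hl'0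
  -- (2) differentiate (1) along `e₂` at `y` (legitimate: (1) holds on the open set `U`)
  have hd : ∀ k : Fin 3, Differentiable ℝ (pderiv k w) := fun k => (contDiff_pderiv hws k).differentiable (by simp)
  have h2 : ξ 0 * pderiv 2 (pderiv 0 w) y + ξ 1 * pderiv 2 (pderiv 1 w) y = 0 := by
    set φ : ℝ³ → ℝ := fun x => ξ 0 * pderiv 0 w x + ξ 1 * pderiv 1 w x with hφ
    have hev : φ =ᶠ[𝓝 y] fun _ => (0 : ℝ) := Filter.eventuallyEq_of_mem (hU.mem_nhds hy) horth
    have hφy : pderiv 2 φ y = 0 := by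
      rw [pderiv_apply, hev.fderiv_eq]
      simp
    have hexp : pderiv 2 φ = fun x => ξ 0 * pderiv 2 (pderiv 0 w) x + ξ 1 * pderiv 2 (pderiv 1 w) x := by
      rw [hφ, pderiv_add ((hd 0).const_mul _) ((hd 1).const_mul _), pderiv_const_mul (hd 0),
        pderiv_const_mul (hd 1)]
    rw [hexp] at hφy
    exact hφy
  -- (3) Schwarz, and identification of the four first/second derivatives in `twist`
  rw [pderiv_comm hws 2 0, pderiv_comm hws 2 1] at h2
  have hB : ∀ k : Fin 3, fderiv ℝ (fun x => fderiv ℝ u x (𝐞 2) 2) y (𝐞 k) = pderiv k (pderiv 2 w) y := by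
    intro k
    have hfun : (fun x => fderiv ℝ u x (𝐞 2) 2) = pderiv 2 w := funext fun x => (hpd x 2).symm
    rw [hfun]
    rfl
  unfold twist
  rw [hB 0, hB 1, ← hpd y 1, ← hpd y 0]
  exact det_eq_zero_of_orth hξ (horth y hy) h2


/-- **Class-level form: constant-direction windows are regular (the Giga–Miura class is covered by the TREE).**  For a profile of
the crux class, poloidal along `e₂` on every slice, and an open space–time window `W` in the backward slab on which the
non-degeneracy clause of `stub_twisting` holds and ON EACH SLICE the vorticity direction is constant (`curl v(t) y = l(t,y) • ξ(t)`),
the apex is not a backward singular point — by `twist_eq_zero_of_constDir` (the window is untwisted) and the landed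
`stub_untwisted` (p561151).  So the print exclusion (P1) of the census needs no literature fact: it is a kernel consequence of the
untwisted stratum.  (First integral from the landed `stub_firstIntegral`; slice smoothness from `contDiff_slice`.) [folklore] -/
theorem not_singular_of_constDir_window (C : ℝ) (v : ℝ → ℝ³ → ℝ³) (hrate : HasTypeITimeDecay C v)
    (hcont : ContinuousOn (uncurry v) (Iio (0 : ℝ) ×ˢ univ))
    (hmild : ∀ s t : ℝ, s < t → t < 0 → ∀ x,
      v t x = UnboundedOperators.heatExtension (v s) (t - s) x - oseenDuhamel 1 s v v t x)
    (hdiv : ∀ t < 0, VectorCalculus.IsDivFree (v t))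
    (hpol : ∀ s < 0, ∀ y, ⟪curl (v s) y, 𝐞 2⟫_ℝ = 0)
    (W : Set (ℝ × ℝ³)) (hW : IsOpen W) (hWne : W.Nonempty) (hWs : W ⊆ Iio (0 : ℝ) ×ˢ univ)
    (hND : ∀ z ∈ W, curl (v z.1) z.2 ≠ 0 ∧
      (fderiv ℝ (v z.1) z.2 (𝐞 0) 2 ≠ 0 ∨ fderiv ℝ (v z.1) z.2 (𝐞 1) 2 ≠ 0) ∧
      (fderiv ℝ (v z.1) z.2 (𝐞 2) 0 ≠ 0 ∨ fderiv ℝ (v z.1) z.2 (𝐞 2) 1 ≠ 0))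
    (ξ : ℝ → ℝ³) (hdir : ∀ z ∈ W, ∃ l : ℝ, curl (v z.1) z.2 = l • ξ z.1) :
    ¬ IsBackwardSingularPoint v 0 := by
  refine Summit.NavierStokesRegularity.NavierStokesRegularity.Theorems.PoloidalWindowDoorPoloidalWindowRigidityStubUntwisted.stub_untwisted
    C v hrate hcont hmild hdiv hpol W hW hWne hWs hND fun z hz => ?_
  have hs : z.1 < 0 := (Set.mem_prod.mp (hWs hz)).1
  -- the slice of the window through `z`
  set U : Set ℝ³ := (fun y : ℝ³ => (z.1, y)) ⁻¹' W with hU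
  have hUo : IsOpen U := hW.preimage (continuous_const.prodMk continuous_id)
  have hzU : z.2 ∈ U := by simpa [hU] using hz
  have hfi := Summit.NavierStokesRegularity.NavierStokesRegularity.Theorems.PoloidalWindowDoorPoloidalWindowRigidityFirstIntegral.stub_firstIntegral
    C v hrate hcont hmild hdiv (𝐞 2) hpol z.1 hs
  have h := twist_eq_zero_of_constDir (contDiff_slice hrate hcont hmild hs) hUo (ξ z.1)
    (fun y hy => hdir (z.1, y) hy) (fun y hy => (hND (z.1, y) hy).1)
    (fun y _ => by simpa [EuclideanSpace.inner_single_right] using hpol z.1 hs y) (fun y _ => hfi y) z.2 hzU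
  simpa [twist] using h

/-! ## §C  The census, typed (statements only — `Prop`s, no axioms; see the module docstring for locators) -/

/-- The hypotheses of `stub_twisting` up to and including poloidality, bundled: the crux class, poloidal along `e₂` on every slice. -/
def InTwistingSetup (C : ℝ) (v : ℝ → ℝ³ → ℝ³) : Prop :=
  HasTypeITimeDecay C v ∧ ContinuousOn (uncurry v) (Iio (0 : ℝ) ×ˢ univ) ∧
    (∀ s t : ℝ, s < t → t < 0 → ∀ x,
      v t x = UnboundedOperators.heatExtension (v s) (t - s) x - oseenDuhamel 1 s v v t x) ∧
    (∀ t < 0, VectorCalculus.IsDivFree (v t)) ∧ (∀ s < 0, ∀ y, ⟪curl (v s) y, 𝐞 2⟫_ℝ = 0)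

/-- A twisting window: an open space–time set in the backward slab on which the non-degeneracy clause of `stub_twisting` holds and
the twist density is nowhere zero. -/
def IsTwistingWindow (v : ℝ → ℝ³ → ℝ³) (W : Set (ℝ × ℝ³)) : Prop :=
  IsOpen W ∧ W.Nonempty ∧ W ⊆ Iio (0 : ℝ) ×ˢ univ ∧
    (∀ z ∈ W, curl (v z.1) z.2 ≠ 0 ∧
      (fderiv ℝ (v z.1) z.2 (𝐞 0) 2 ≠ 0 ∨ fderiv ℝ (v z.1) z.2 (𝐞 1) 2 ≠ 0) ∧
      (fderiv ℝ (v z.1) z.2 (𝐞 2) 0 ≠ 0 ∨ fderiv ℝ (v z.1) z.2 (𝐞 2) 1 ≠ 0)) ∧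
    ∀ z ∈ W, twist (v z.1) z.2 ≠ 0

/-- The Clebsch slope of `stub_twisting`'s (TV)/(TH) split at a space–time point: `m` with `∂₂v_b = m · ∂_b v₂` for the horizontal
index `b` (the quantity the stub's `∀ m : ℝ → ℝ` clause says is NOT a function of time alone on any sub-window). -/
def HasSlopeAt (v : ℝ → ℝ³ → ℝ³) (z : ℝ × ℝ³) (m : ℝ) : Prop :=
  ∀ b : Fin 3, b ≠ 2 → fderiv ℝ (v z.1) z.2 (𝐞 2) b = m * fderiv ℝ (v z.1) z.2 (𝐞 b) 2

/-- (TH) on a window: the slope is a function of `(t, x₂)` only. -/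
def IsTimeHeightSlope (v : ℝ → ℝ³ → ℝ³) (W : Set (ℝ × ℝ³)) : Prop :=
  ∃ m : ℝ → ℝ → ℝ, ∀ z ∈ W, HasSlopeAt v z (m z.1 (z.2 2))

/-- THICK on a window: on no open nonempty sub-window is the slope a function of `(t, x₂)` only. -/
def IsThick (v : ℝ → ℝ³ → ℝ³) (W : Set (ℝ × ℝ³)) : Prop :=
  ∀ W₁ ⊆ W, IsOpen W₁ → W₁.Nonempty → ¬ IsTimeHeightSlope v W₁

/-- The (TV)-exclusion clause of `stub_twisting`, VERBATIM: on no open nonempty sub-window is the slope a function of time alone. -/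
def IsNotTV (v : ℝ → ℝ³ → ℝ³) (W : Set (ℝ × ℝ³)) : Prop :=
  ∀ m : ℝ → ℝ, ∀ W₁ : Set (ℝ × ℝ³), W₁ ⊆ W → IsOpen W₁ → W₁.Nonempty →
    ∃ z ∈ W₁, ∃ b : Fin 3, b ≠ 2 ∧ fderiv ℝ (v z.1) z.2 (𝐞 2) b ≠ m z.1 * fderiv ℝ (v z.1) z.2 (𝐞 b) 2

/-- **`stub_twisting` (Lines/lrc_jet.lean v5) VERBATIM, as a `Prop`** (the Lines file is not importable into Theorems-side files; this
copy is character-for-character its statement, with `ℝ³`/`𝐞` abbreviating `EuclideanSpace ℝ (Fin 3)` / `EuclideanSpace.single _ 1`). -/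
def StubTwisting : Prop :=
  ∀ (C : ℝ) (v : ℝ → ℝ³ → ℝ³),
    HasTypeITimeDecay C v →
    ContinuousOn (uncurry v) (Iio (0 : ℝ) ×ˢ univ) →
    (∀ s t : ℝ, s < t → t < 0 → ∀ x, v t x =
      UnboundedOperators.heatExtension (v s) (t - s) x - oseenDuhamel 1 s v v t x) →
    (∀ t < 0, VectorCalculus.IsDivFree (v t)) →
    (∀ s < 0, ∀ y, ⟪curl (v s) y, 𝐞 2⟫_ℝ = 0) →
    ∀ W : Set (ℝ × ℝ³), IsOpen W → W.Nonempty → W ⊆ Iio (0 : ℝ) ×ˢ univ →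
      (∀ z ∈ W, curl (v z.1) z.2 ≠ 0 ∧
        (fderiv ℝ (v z.1) z.2 (𝐞 0) 2 ≠ 0 ∨ fderiv ℝ (v z.1) z.2 (𝐞 1) 2 ≠ 0) ∧
        (fderiv ℝ (v z.1) z.2 (𝐞 2) 0 ≠ 0 ∨ fderiv ℝ (v z.1) z.2 (𝐞 2) 1 ≠ 0)) →
      (∀ m : ℝ → ℝ, ∀ W₁ : Set (ℝ × ℝ³), W₁ ⊆ W → IsOpen W₁ → W₁.Nonempty →
        ∃ z ∈ W₁, ∃ b : Fin 3, b ≠ 2 ∧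
          fderiv ℝ (v z.1) z.2 (𝐞 2) b ≠ m z.1 * fderiv ℝ (v z.1) z.2 (𝐞 b) 2) →
      (∀ z ∈ W,
        fderiv ℝ (fun x => fderiv ℝ (v z.1) x (𝐞 2) 2) z.2 (𝐞 0) * fderiv ℝ (v z.1) z.2 (𝐞 1) 2 -
          fderiv ℝ (fun x => fderiv ℝ (v z.1) x (𝐞 2) 2) z.2 (𝐞 1) * fderiv ℝ (v z.1) z.2 (𝐞 0) 2 ≠ 0) →
      ¬ IsBackwardSingularPoint v 0

/-- CENSUS LINE (open; finite-certificate lane cert-1 / nsreg-p7 / `mixed_type::stub_hyperbolicTH`): a singular profile of the class with a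
twisting, (TV)-pinned window on which the slope is a function of `(t, x₂)`.  KINEMATICALLY inhabited once (M) is dropped (refuter1 K-47
`twistProfile`, p565534 + sequels); NS-status open. -/
def TwistingTHResidue : Prop :=
  ∃ (C : ℝ) (v : ℝ → ℝ³ → ℝ³) (W : Set (ℝ × ℝ³)), InTwistingSetup C v ∧ IsTwistingWindow v W ∧ IsNotTV v W ∧
    IsTimeHeightSlope v W ∧ IsBackwardSingularPoint v 0

/-- CENSUS LINE (open; no witness of any kind known — refuter1 K-47/K-48, this file §S; `mixed_type::stub_hyperbolicThick` ∪ the thick part of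
`stub_semiElliptic`): a singular profile of the class with a THICK twisting window. -/
def TwistingThickResidue : Prop :=
  ∃ (C : ℝ) (v : ℝ → ℝ³ → ℝ³) (W : Set (ℝ × ℝ³)), InTwistingSetup C v ∧ IsTwistingWindow v W ∧ IsThick v W ∧
    IsBackwardSingularPoint v 0

/-- Thick windows are (TV)-pinned (a time-only slope is a special `(t, x₂)`-slope). -/
theorem isNotTV_of_isThick {v : ℝ → ℝ³ → ℝ³} {W : Set (ℝ × ℝ³)} (h : IsThick v W) : IsNotTV v W := by
  intro m W₁ hW₁ hW₁o hW₁ne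
  by_contra hcon
  push Not at hcon
  exact h W₁ hW₁ hW₁o hW₁ne ⟨fun t _ => m t, fun z hz b hb => hcon z hz b hb⟩

/-- **EXACTLY WHAT REMAINS (kernel): `stub_twisting` ⇔ no (TH) residue and no THICK residue.**  The twisting half of the picked line is
equivalent to the conjunction of the two census lines above being empty — nothing else hides in it.  (Classical case split on whether some
sub-window carries a `(t,x₂)`-slope; restriction of the window keeps every hypothesis.) -/
theorem stubTwisting_iff_residues : StubTwisting ↔ (¬ TwistingTHResidue ∧ ¬ TwistingThickResidue) := by
  constructor
  · intro hS
    refine ⟨?_, ?_⟩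
    · rintro ⟨C, v, W, ⟨hrate, hcont, hmild, hdiv, hpol⟩, ⟨hW, hWne, hWs, hND, htw⟩, hTV, -, hsing⟩
      exact hS C v hrate hcont hmild hdiv hpol W hW hWne hWs hND hTV (fun z hz => htw z hz) hsing
    · rintro ⟨C, v, W, ⟨hrate, hcont, hmild, hdiv, hpol⟩, ⟨hW, hWne, hWs, hND, htw⟩, hth, hsing⟩
      exact hS C v hrate hcont hmild hdiv hpol W hW hWne hWs hND (isNotTV_of_isThick hth) (fun z hz => htw z hz) hsing
  · rintro ⟨hTH, hThick⟩ C v hrate hcont hmild hdiv hpol W hW hWne hWs hND hTV htw hsing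
    by_cases h : ∃ W₁ ⊆ W, IsOpen W₁ ∧ W₁.Nonempty ∧ IsTimeHeightSlope v W₁
    · obtain ⟨W₁, hW₁, hW₁o, hW₁ne, hslope⟩ := h
      refine hTH ⟨C, v, W₁, ⟨hrate, hcont, hmild, hdiv, hpol⟩, ⟨hW₁o, hW₁ne, hW₁.trans hWs,
        fun z hz => hND z (hW₁ hz), fun z hz => htw z (hW₁ hz)⟩, ?_, hslope, hsing⟩
      intro m W₂ hW₂ hW₂o hW₂ne
      exact hTV m W₂ (hW₂.trans hW₁) hW₂o hW₂ne
    · push Not at h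
      exact hThick ⟨C, v, W, ⟨hrate, hcont, hmild, hdiv, hpol⟩, ⟨hW, hWne, hWs, hND, htw⟩,
        fun W₁ hW₁ hW₁o hW₁ne hs => h W₁ hW₁ hW₁o hW₁ne hs, hsing⟩

/-- PRINT (P2) [cite: Lei–Ren arXiv:2501.08976, p.4 Thm 1.1; Rem 1.3 p.4 L40–52]: bounded ancient mild solutions that are poloidal
in their (axisymmetric-geometry) sense are constant; the NON-axisymmetric `ω₃ ≡ 0` case is flagged OPEN there.  Recorded as the
statement that the twisting residues above are not settled by print: -/
def PrintLeavesTwistingOpen : Prop := ¬ (TwistingTHResidue ∨ TwistingThickResidue) -- ⇔ `StubTwisting` (`stubTwisting_iff_residues`)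

/-! ## §S  Symmetric (oblique-2.5D) twisting germs: the reduced system, typed; the numerical verdict as a `sorry`d statement -/

/-- `X`-partial of a function of `(X, Y)`. -/
def dX (f : ℝ → ℝ → ℝ) (X Y : ℝ) : ℝ := deriv (fun X' => f X' Y) X
/-- `Y`-partial of a function of `(X, Y)`. -/
def dY (f : ℝ → ℝ → ℝ) (X Y : ℝ) : ℝ := deriv (fun Y' => f X Y') Y

/-- **The oblique-2.5D steady poloidal NS system** (§S; NOTES.md §2.5D for the paper equivalence with steady NS + poloidal along
`e₂` + frozen, for fields invariant under translation along `d = (sin β, 0, cos β)`, `T = tan β ≠ 0`): unknowns `g` (velocity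
along `d`), `ℬ` (velocity along `e_y`), the frozen profile `W = U + T·id` (`u_A = U(g)`), the pressure gradient `c` along `d`,
on an open set `O ⊆ ℝ²_{(X,Y)}`; all real-analytic. -/
structure IsOblique25Germ (T c : ℝ) (W : ℝ → ℝ) (g ℬ : ℝ → ℝ → ℝ) (O : Set (ℝ × ℝ)) : Prop where
  isOpen : IsOpen O
  nonempty : O.Nonempty
  T_ne : T ≠ 0
  analytic_g : AnalyticOnNhd ℝ (uncurry g) O
  analytic_B : AnalyticOnNhd ℝ (uncurry ℬ) O
  analytic_W : AnalyticOnNhd ℝ W univ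
  /-- (E1) `ℬ_X = W′(g) g_Y` -/
  E1 : ∀ z ∈ O, dX ℬ z.1 z.2 = deriv W (g z.1 z.2) * dY g z.1 z.2
  /-- (E2) `ℬ_Y = −U′(g) g_X`, `U′ = W′ − T` -/
  E2 : ∀ z ∈ O, dY ℬ z.1 z.2 = -(deriv W (g z.1 z.2) - T) * dX g z.1 z.2
  /-- (γ) `Δg = U(g) g_X + ℬ g_Y + c`, `U = W − T·id` -/
  gamma : ∀ z ∈ O, dX (dX g) z.1 z.2 + dY (dY g) z.1 z.2 =
    (W (g z.1 z.2) - T * g z.1 z.2) * dX g z.1 z.2 + ℬ z.1 z.2 * dY g z.1 z.2 + c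

/-- Twist of a 2.5D germ (up to the nonzero factor coming from the frame): `g_XX g_Y − g_XY g_X`. -/
def twist25 (g : ℝ → ℝ → ℝ) (X Y : ℝ) : ℝ := dX (dX g) X Y * dY g X Y - dX (dY g) X Y * dX g X Y

/-- **Numerical verdict of §S, recorded as a statement (NOT proved): no THICK symmetric twisting germ.**  Every oblique-2.5D germ
that twists somewhere has `W″ = 0` along `g` on some open sub-window (there the slope is constant: (TV)).  Evidence: the finite-type
prolongation tower (I₁ and its derivatives) has no common zero with `W″(g₀) ≠ 0` up to order 4 in the multistart searches of kit jobs
j289657 / j289848 (order-4 floors ≥ 1.1e-2 at 60 exact order-≤3 points vs ≤ 5e-33 for the W-linear control; re-optimisation reaches small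
residuals only along the degenerate `T → ∞` escape; with W″ FREE the search converges to W″ = W‴ = W⁗ = 0 exactly); parameter count says order 4
is the first over-determined level.  OBSTRUCTION to a proof here: the genuine order-k conditions are
polynomials with 10³–10⁶ terms; an exact elimination (resultants / Gröbner over ℚ on the 11 jet variables) was not attempted in this
session.  A proof would make «symmetric twisting ⇒ (TV)» a theorem and pin the thick residue as symmetry-free. -/
theorem noThickObliqueTwistingGerm (T c : ℝ) (W : ℝ → ℝ) (g ℬ : ℝ → ℝ → ℝ) (O : Set (ℝ × ℝ))
    (h : IsOblique25Germ T c W g ℬ O) (htw : ∃ z ∈ O, twist25 g z.1 z.2 ≠ 0) :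
    ∃ O₁ ⊆ O, IsOpen O₁ ∧ O₁.Nonempty ∧ ∀ z ∈ O₁, deriv (deriv W) (g z.1 z.2) = 0 := by
  sorry

/-! ### The explicit (TV) twisting member of §S (branch `b = T`: `U ≡ 0`, `W = T·id`, `ℬ = aX`, `c = 0`), kernel-checked:
the reduced system IS inhabited by twisting germs — with constant slope. -/

/-- The cubic example's `g = aY/T + a²X³/(6T)`. -/
def gCubic (T a : ℝ) (X Y : ℝ) : ℝ := a * Y / T + a ^ 2 * X ^ 3 / (6 * T)

theorem dX_const2 (k : ℝ) : dX (fun _ _ => k) = fun _ _ => 0 := by funext X Y; simp [dX]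
theorem dY_const2 (k : ℝ) : dY (fun _ _ => k) = fun _ _ => 0 := by funext X Y; simp [dY]
theorem dY_indep (h : ℝ → ℝ) : dY (fun X _ => h X) = fun _ _ => 0 := by funext X Y; simp [dY]

theorem deriv_linear (T x : ℝ) : deriv (fun w : ℝ => T * w) x = T := by
  rw [((hasDerivAt_id' x).const_mul T).deriv]; ring

theorem dX_gCubic (T a : ℝ) : dX (gCubic T a) = fun X _ => a ^ 2 * X ^ 2 / (2 * T) := by
  funext X Y
  simp only [dX, gCubic]
  have h : HasDerivAt (fun X' : ℝ => a * Y / T + a ^ 2 * X' ^ 3 / (6 * T))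
      (0 + a ^ 2 * ((3 : ℕ) * X ^ (3 - 1) * 1) / (6 * T)) X :=
    (hasDerivAt_const X _).add (((hasDerivAt_id' X).pow 3).const_mul (a ^ 2) |>.div_const (6 * T))
  rw [h.deriv]; push_cast; ring

theorem dY_gCubic (T a : ℝ) : dY (gCubic T a) = fun _ _ => a / T := by
  funext X Y
  simp only [dY, gCubic]
  have h : HasDerivAt (fun Y' : ℝ => a * Y' / T + a ^ 2 * X ^ 3 / (6 * T)) (a * 1 / T + 0) Y :=
    (((hasDerivAt_id' Y).const_mul a).div_const T).add (hasDerivAt_const Y _)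
  rw [h.deriv]; ring

theorem dX_sq (T a : ℝ) : dX (fun X _ => a ^ 2 * X ^ 2 / (2 * T)) = fun X _ => a ^ 2 * X / T := by
  funext X Y
  simp only [dX]
  have h : HasDerivAt (fun X' : ℝ => a ^ 2 * X' ^ 2 / (2 * T)) (a ^ 2 * ((2 : ℕ) * X ^ (2 - 1) * 1) / (2 * T)) X :=
    (((hasDerivAt_id' X).pow 2).const_mul (a ^ 2)).div_const (2 * T)
  rw [h.deriv]; push_cast; field_simp

theorem dX_lin (a : ℝ) : dX (fun X _ : ℝ => a * X) = fun _ _ => a := by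
  funext X Y; simp only [dX]; exact deriv_linear a X

theorem analyticOnNhd_gCubic (T a : ℝ) : AnalyticOnNhd ℝ (uncurry (gCubic T a)) univ := by
  have : uncurry (gCubic T a) = fun z : ℝ × ℝ => a * z.2 / T + a ^ 2 * z.1 ^ 3 / (6 * T) := by
    funext z; rfl
  rw [this]
  intro z _
  have h1 : AnalyticAt ℝ (fun z : ℝ × ℝ => z.1) z := analyticAt_fst
  have h2 : AnalyticAt ℝ (fun z : ℝ × ℝ => z.2) z := analyticAt_snd
  exact ((analyticAt_const.mul h2).div_const).add ((analyticAt_const.mul (h1.pow 3)).div_const)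

theorem analyticOnNhd_lin (a : ℝ) : AnalyticOnNhd ℝ (uncurry fun X _ : ℝ => a * X) univ := by
  have : (uncurry fun X _ : ℝ => a * X) = fun z : ℝ × ℝ => a * z.1 := by funext z; rfl
  rw [this]
  intro z _
  exact analyticAt_const.mul analyticAt_fst

/-- **The cubic (TV) twisting germ solves the oblique-2.5D system and twists** (`T ≠ 0`, `a ≠ 0`; velocity
`v = (aX) e_y + g d`, `g = aY/T + a²X³/(6T)`, zero pressure gradient along `d`): elementary calculus, kernel-checked. [folklore] -/
theorem oblique25_cubic_example (T a : ℝ) (hT : T ≠ 0) (ha : a ≠ 0) :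
    IsOblique25Germ T 0 (fun w => T * w) (gCubic T a) (fun X _ => a * X) univ ∧ twist25 (gCubic T a) 1 0 ≠ 0 := by
  refine ⟨⟨isOpen_univ, univ_nonempty, hT, analyticOnNhd_gCubic T a, analyticOnNhd_lin a,
    fun w _ => analyticAt_const.mul analyticAt_id, fun z _ => ?_, fun z _ => ?_, fun z _ => ?_⟩, ?_⟩
  · rw [dX_lin, deriv_linear, dY_gCubic]; field_simp
  · rw [dY_indep, deriv_linear]; ring
  · rw [dX_gCubic, dX_sq, dY_gCubic, dY_const2]; field_simp; ring
  · simp only [twist25, dX_gCubic, dY_gCubic, dX_sq, dX_const2]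
    have : a ^ 2 * 1 / T * (a / T) - 0 * (a ^ 2 * 1 ^ 2 / (2 * T)) = a ^ 3 / T ^ 2 := by field_simp; ring
    rw [this]
    exact div_ne_zero (pow_ne_zero 3 ha) (pow_ne_zero 2 hT)

end Summit.NavierStokesRegularity.NavierStokesRegularity.Cruxes.PoloidalWindowRigidity.Disproof
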